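import Summits.BirchSwinnertonDyer.Rank1Residual.X11b.RegMultShaAnCertificate
import HarnessLib

/-!
# Class X11b = N8 (census cell, seat `census-ctyper-2`, H-7 SHAAN, schema AMENDMENT A5): the
# EXACTNESS input `hden` of an S-REAL `#Ш_an` row from the printed Gross–Zagier shape
# `#Ш_an = R · I²` ('tranche D' — per curve, explicit `R`, integral Heegner index `I`)

HONEST FRAMING (verbatim, cell `b2b-bsdres`, run/shared/lean/b2b/bsd-rank1-residual/): the goal of
the cell is to DELETE the COMBINATION-SHAPED residual classes for ALL analytic-rank `≤ 1` curves
over `ℚ` — 'full BSD formula for every rank `≤ 1` curve in class C' assembled STRICTLY from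
published theorems — so that the rank-`≤ 1` remainder becomes exactly the CONSTRUCTION-SHAPED
classes, which are TYPED (missing-input Props), NOT attempted; this is not 'finishing BSD'.
Research routes; no claim beyond stated classes; census / instrument output = EVIDENCE /
certificate rows (instrumentation tier — what a certified row is worth is referee A's / the
director's ruling), never a Literature fact; nothing here books anything or changes a label or a
RESIDUAL-MAP mark; class X11b stays CONSTRUCTION-SHAPED.

## Why this file

`RegMult.bsdp_of_katoSurj_of_cert_of_shaAnBall` (`RegMultShaAnCertificate.lean` §1, p255944) closes
`BSD(E,p)` on a `¬Ram` N8 cell from the published facts + ONE REGMULT row + an archimedean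
two-engine BALL `|s - n| < 1/D` for THE rational `s = #Ш_an(E)` + `p ∤ n` + the EXACTNESS input
`hden : s.den ≤ D`, which NO engine delivers. The census schema (`SHAAN-CERT-SCHEMA.md` §0) asked
readers to name any printed denominator control. There is one — PER CURVE, not class-wide:

* Grigorov–Jorza–Patrikis–Stein–Tarniţǎ, *Computational verification of the Birch and
  Swinnerton-Dyer conjecture for individual elliptic curves*, Math. Comp. 78 (2009) 2397–2425, proof
  of Thm. 1.8 (p. 2398), verbatim: "For the curves of rank 1, Cremona computed a numerical
  approximation to `#Ш(E)_an` to at least 10 digits of precision. Using the Gross–Zagier formula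
  (see (3.2)) we obtain an explicit formula for `#Ш(E)_an` that shows that `#Ш(E)_an` is a rational
  number with bounded denominator. We explicitly computed such a bound for all curves of rank 1 and
  conductor `≤ 1000` and it was at most `5248800`, which is much smaller than `10^10`. Thus
  `#Ш(E)_an = 1` for each elliptic curve of rank 1 and conductor `≤ 1000`." — with §3.2 Thm. 3.11
  (the Gross–Zagier formula for `ĥ(y_K)`: Gross–Zagier 1986 for odd `D`, Zhang 2004 Thm. 6.1 in
  general), §3.3 (GZ86 Conj. V.(2.2), the index form), §3.4 Props. 3.15–3.17 (over a Heegner field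
  `K` with `ord_{s=1} L(E/K,s) = 1` exactly one of `E`, `E^D` has rank one and its `ℚ`-points have
  index `≤ 2` in `E(K)/tors`; `L(E/K,s) = L(E,s)·L(E^D,s)`), §3.5 Alg. 3.20.
* R. L. Miller, *Proving the Birch and Swinnerton-Dyer conjecture for specific elliptic curves of
  analytic rank zero and one*, LMS J. Comput. Math. 14 (2011) 327–350, §4: "For `r_an(E) ≤ 1`, we
  can (at least in theory) compute `#Ш(ℚ,E)_an` exactly, as first described in [GZ86]"; Cor. 4.8.

The SHAPE behind these sentences: `#Ш_an(E) = R · I_K²` with `I_K = [E(K)/tors : ℤ y_K] ∈ ℤ`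
(unknown but INTEGRAL) and `R ∈ ℚ` EXPLICIT per curve (Manin constant, `u_K`, the index `≤ 2`,
torsion orders, Tamagawa numbers, the exact rational `L(E^D,1)/Ω(E^D)` of the rank-zero twist,
powers of `2`; the explicit Gross–Zagier constant is the tree's `grossZagierConstant`,
`Literature/…/HeegnerPoints.lean`, Cai–Shu–Tian 2014 Thm. 1.1). ONLY the integrality of `I` and the
explicit `R` matter for `hden`: `s.den ≤ R.den`. So an S-REAL ball of radius `< 1/R.den` makes
`#Ш_an` EXACT and feeds p255944 / p254954 as written. Deriving `R` for a given pair from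
`gross_zagier` and the BSD quotient is NOT done here (it is the row's input, a separate cited
port); nothing booked; per pair; EVIDENCE road.

## Contents (theorems only; 0 definitions, 0 named facts)

`Rat.den_le_den_of_eq_mul_intCast_sq` (`s = R·I²`, `I : ℤ` ⇒ `s.den ≤ R.den`),
`RegMult.padicValRat_le_zero_of_ball_of_eq_mul_sq`,
`RegMult.bsdp_of_katoSurj_of_cert_of_shaAnBall_of_eq_mul_sq`.

References: [GrigorovJorzaPatrikisSteinTarnita2009] proof of Thm. 1.8 (p. 2398), §3.2–3.5;
[Miller2011LMS] Def. 1.1, §4, Cor. 4.8; [GrossZagier1986] Thm. I.(7.3), V.(2.2); [Wuthrich2014]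
Thm. 3; [SteinWuthrich2013] Thm. 6.1, §4.2; [Disegni2020] Thm. 1.
-/

noncomputable section

open scoped Classical MatrixGroups ModularForm

open CongruenceSubgroup WeierstrassCurve
open Literature.NumberTheory.EllipticCurves
  Literature.NumberTheory.EllipticCurves.ModularForms
  Literature.NumberTheory.EllipticCurves.Rank1Residual
  Literature.NumberTheory.EllipticCurves.Rank1Residual.Typed
  Literature.NumberTheory.EllipticCurves.Wuthrich2014
  Literature.NumberTheory.EllipticCurves.SteinWuthrich2013
  Literature.NumberTheory.EllipticCurves.Disegni2020
  Literature.NumberTheory.EllipticCurves.Skinner2016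

/-- **Denominator control from the Gross–Zagier shape.** If a rational `s` (`= #Ш_an(E)`) has the
form `s = R · I²` with `I` an INTEGER (the Heegner index) and `R` an explicit rational, then
`s.den ≤ R.den` — the EXACTNESS input `hden` of `RegMult.bsdp_of_katoSurj_of_cert_of_shaAnBall`
with `D := R.den`, whatever the (unknown) index `I` is. Pure arithmetic of `Rat.den`.
[cite: GrigorovJorzaPatrikisSteinTarnita2009, proof of Thm. 1.8 (p. 2398), §3.2 Thm. 3.11, §3.4]
[cite: Miller2011LMS, §4, Cor. 4.8] -/
theorem Rat.den_le_den_of_eq_mul_intCast_sq {s R : ℚ} {I : ℤ} (h : s = R * (I : ℚ) ^ 2) :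
    s.den ≤ R.den := by
  subst h
  have h1 : ((I : ℚ) ^ 2).den = 1 := by
    rw [show ((I : ℚ) ^ 2) = ((I ^ 2 : ℤ) : ℚ) by push_cast; rfl]
    exact Rat.den_intCast _
  have hd : (R * (I : ℚ) ^ 2).den ∣ R.den := by
    have h2 := Rat.mul_den_dvd R ((I : ℚ) ^ 2)
    rwa [h1, mul_one] at h2
  exact Nat.le_of_dvd R.den_pos hd

namespace Summit.BirchSwinnertonDyer.Rank1Residual.X11b

namespace RegMult

variable (W : WeierstrassCurve ℚ) [W.IsElliptic] [W.IsGloballyMinimal] (p : ℕ) [Fact p.Prime]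

omit [W.IsElliptic] [W.IsGloballyMinimal] [Fact p.Prime] in
/-- **An S-REAL row + the Gross–Zagier shape in the kernel's currency**: `s = R · I²` (`I : ℤ`), a
two-engine ball `|s - n| < 1/R.den` around a natural number `n`, and `p ∤ n`, give
`padicValRat p s ≤ 0` (indeed `s = n`) — the `hv` input of p254954's
`bsdp_of_katoSurj_of_cert_of_padicValRat_shaAn_le`, with NO assumption on `#Ш_an` beyond the
printed shape. [cite: GrigorovJorzaPatrikisSteinTarnita2009, proof of Thm. 1.8 (p. 2398)]
[cite: Miller2011LMS, Def. 1.1, §4] -/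
theorem padicValRat_le_zero_of_ball_of_eq_mul_sq {s R : ℚ} {I : ℤ} (hR : s = R * (I : ℚ) ^ 2)
    {n : ℕ} (hball : |s - n| < 1 / R.den) (hn : ¬ p ∣ n) : padicValRat p s ≤ 0 :=
  padicValRat_le_zero_of_ball_of_den_le p (Rat.den_le_den_of_eq_mul_intCast_sq hR) hball hn

/-- **Per-pair closure from ONE REGMULT row + an S-REAL `#Ш_an` ball + the printed Gross–Zagier
shape ('tranche D')**: `bsdp_of_katoSurj_of_cert_of_shaAnBall` (p255944) with its EXACTNESS input
`hden` discharged by `hR : s = R · I²` (`R` the explicit rational of the pair — Manin constant,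
`u_K`, index `≤ 2`, torsion, Tamagawa numbers, exact rank-zero twist quotient —, `I` the integral
Heegner index, which need NOT be known) and the ball taken at radius `1/R.den`. CONDITIONAL on the
named facts of p254954 (Kato–Wuthrich A32, Stein–Wuthrich 6.1/§4.2 + the two height-existence
facts, Disegni Thm. 1, GZK, modularity); the identity `s = R · I²` itself is the row's input (its
derivation from `gross_zagier` + the BSD quotient is a separate cited port, not claimed here); per
pair; nothing booked. [cite: GrigorovJorzaPatrikisSteinTarnita2009, proof of Thm. 1.8 (p. 2398), §3.2–§3.5]
[cite: Miller2011LMS, §4, Cor. 4.8] [cite: Wuthrich2014, Thm. 3 (p. 383)]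
[cite: SteinWuthrich2013, Thm. 6.1, §4.2] [cite: Disegni2020, Thm. 1 (§1.2), (∗)] -/
theorem bsdp_of_katoSurj_of_cert_of_shaAnBall_of_eq_mul_sq
    (hK : kato_charIdeal_dvd_multiplicative_of_surjective)
    (hJn : thm61_nonsplitMultiplicative) (hJs : thm61_splitMultiplicative)
    (hHn : exists_isMultCanonical) (hHs : exists_isSplitMultCanonical)
    (hD : thm1_padicBSD_rankOne_multiplicative)
    (hGZK : rank_eq_analyticRank_of_analyticRank_le_one) (hpar : nonempty_modularParametrizationData)
    (hp5 : 5 ≤ p) (hX : ClassX11b W p) (hsurj : Surj W p)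
    (hstar : W.HasSplitMultiplicativeReductionAtPrime p →
      ∃ (m : ℕ) (_ : Fact m.Prime), m ≠ p ∧ W.HasMultiplicativeReductionAtPrime m)
    {P : W.toAffine.Point} {m : ℕ}
    (hcn : ¬ W.HasSplitMultiplicativeReductionAtPrime p → CertNonsplit W p P m)
    (hcs : W.HasSplitMultiplicativeReductionAtPrime p → CertSplit W p P m)
    {s : ℚ} (hs : shaAn W = (s : ℂ)) {R : ℚ} {I : ℤ} (hR : s = R * (I : ℚ) ^ 2) {n : ℕ}
    (hball : |s - n| < 1 / R.den) (hn : ¬ p ∣ n) : BSDp W p :=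
  bsdp_of_katoSurj_of_cert_of_shaAnBall W p hK hJn hJs hHn hHs hD hGZK hpar hp5 hX hsurj hstar hcn hcs
    hs (Rat.den_le_den_of_eq_mul_intCast_sq hR) hball hn

end RegMult

end Summit.BirchSwinnertonDyer.Rank1Residual.X11b

end
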